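import Summits.BirchSwinnertonDyer.Rank1Residual.Additive.X3BranchThreeLineCertificateCharacters
import Summits.BirchSwinnertonDyer.Rank1Residual.Additive.X3BranchLineCharacterSqrtTwo
import Summits.BirchSwinnertonDyer.Rank1Residual.Additive.X3ThreeLineDatum
import HarnessLib

/-!
# X3 certificate road at `p = 3`: the per-pair line certificate WITH ITS CHARACTERS for the kernel
# discriminant `D = 2` (kernel field `ℚ(√2)`, character `χ₈` modulo `8`, quotient character
# `ψ = ω₃·χ₈⁻¹` of level `24`) — cell `bsd-eis`, seat `bsd-eis-x3` gen 5; THEOREMS ONLY, nothing booked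

HONEST FRAMING (FULL-BSD rank-`≤ 1` programme D-0033, `run/shared/lean/pub/bsd-eis/README.md` §4;
excluded-domain X3 = additive reducible, row B2 `r = 0`, (M), NON-degenerate). A TOOL: the `D = 2`
analogue of `exists_lineDatum_three_characters_of_cert_prime` (x3 gen 3, prime kernel discriminant
`q ≡ 1 (mod 4)`), which the generated per-pair displays `X3CertificateDisplay<label>.lean` consume. Of
the `1 094` (M) non-degenerate parity-OK rank-`0` classes at `p = 3` (bsd-addord census3), `155` have
kernel discriminant `2` (x3-MEMO-6 ADDENDUM A: "D = 2 / q ≡ 3 (4) / composite packagings not written").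

* `exists_lineDatum_three_kernelField_of_cert'` — bsd-addord's sharper certificate
  `exists_lineDatum_three_of_cert'` (`D` squarefree, `0 < D`, `D ≠ 1`, `3 ∤ D`: no odd prime factor
  needed) with the kernel-field clause `σ` fixes `Φ₀` pointwise iff it fixes `√D` exposed for the SAME
  `Φ₀` (their proof verbatim);
* `chi8_three_isPrimitive` — `χ₈` read in `𝔽₃` is primitive of conductor `8` (`χ₈(5) = −1`,
  `5 ≡ 1 (mod 4)`; the tree's `isPrimitive_of_apply_five_eq_neg_one` argument over `𝔽₃`);
* `exists_lineDatum_three_characters_of_cert_two` — from `Ψ₃(x₀) = 0`, `2·s² = Ψ₂Sq(x₀)`, `s ≠ 0`: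
  the line datum (rational, even, non-trivial action, `χ_K`-twist ramified at `3`) with
  `φ = χ₈ ∘ χ_8` read in `𝔽₃` PRIMITIVE acting on `Φ₀` (`X3Branch.smul_eq_chi8_of_kernel_sq_eq_two`,
  `√2 = ζ₈ + ζ₈⁻¹`) and the PRIMITIVE quotient character `ψ = ω₃·φ⁻¹` of level `3·8` acting on
  `W[3]/Φ₀` (`X3Branch.quotCharacter_isPrimitive`, `X3Branch.smul_sub_quotCharacter_mem`).

References: [GreenbergVatsal2000] §2 p. 28 (the line `Φ`, `φψ = ω`); [Washington1997] Ch. 2–3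
(quadratic subfields of `ℚ(ζ₈)`, conductors); [SilvermanAEC2009] Ex. 3.7 (`Ψ₃`).
-/

set_option autoImplicit false

noncomputable section

open scoped Classical NumberField

namespace Summit.BirchSwinnertonDyer.Rank1Residual.Additive

open WeierstrassCurve Polynomial NumberField IsDedekindDomain Field DirichletCharacter
  Literature.NumberTheory.GaloisRepresentations
  Literature.NumberTheory.EllipticCurves
  Literature.NumberTheory.EllipticCurves.Rank1Residual
  Summit.BirchSwinnertonDyer.Rank1Residual.GaloisImage.RamifiedOrdinaryLineTwist

variable {W : WeierstrassCurve ℚ} [W.IsElliptic]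

/-! ### §1 The sharper line certificate with its kernel field -/

/-- **Per-pair certificate of the `p = 3` line datum, sharper form, kernel field exposed.** As
bsd-addord's `exists_lineDatum_three_of_cert'` (`Ψ₃(x₀) = 0`, `D` squarefree, `s ≠ 0`,
`D·s² = Ψ₂Sq(x₀)`, `0 < D`, `D ≠ 1`, `3 ∤ D`), with the additional clause that `σ ∈ Γ_ℚ` fixes `Φ₀`
pointwise iff it fixes `√D` — for the SAME `Φ₀`. Their proof verbatim. [folklore] -/
theorem exists_lineDatum_three_kernelField_of_cert' [hp : Fact (Nat.Prime 3)] {x₀ s : ℚ} {D : ℤ}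
    (hψ : W.Ψ₃.eval x₀ = 0) (hsq : Squarefree D) (hs : s ≠ 0)
    (hDs : (D : ℚ) * s ^ 2 = W.Ψ₂Sq.eval x₀) (hpos : 0 < D) (hD1 : D ≠ 1) (h3D : ¬ (3 : ℤ) ∣ D) :
    ∃ Φ₀ : AddSubgroup (geomTorsion W ((3 : ℕ) : ℤ)), IsRationalLine W 3 Φ₀ ∧ LineEven W 3 Φ₀ ∧
      (∃ (σ : absoluteGaloisGroup ℚ) (P : W.geomTorsion ((3 : ℕ) : ℤ)), P ∈ Φ₀ ∧ σ • P ≠ P) ∧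
      (∀ (K : Type) [Field K] [NumberField K] [(galRange (K := ℚ) K).Normal],
        Module.finrank ℚ K = 2 →
        (∃ θ : K, θ ^ 2 = algebraMap ℚ K ((-1) ^ ((3 : ℕ) / 2) * (3 : ℕ))) →
        ¬ ∀ v : HeightOneSpectrum (𝓞 ℚ), (((3 : ℕ) : ℕ) : 𝓞 ℚ) ∈ v.asIdeal →
          ∀ 𝔓 ∈ v.primesAbove, ∀ σ ∈ 𝔓.inertia (absoluteGaloisGroup ℚ), ∀ P ∈ Φ₀,
            σ • P = (if σ ∈ galRange (K := ℚ) K then P else -P)) ∧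
      ∀ σ : absoluteGaloisGroup ℚ, (∀ Q ∈ Φ₀, σ • Q = Q) ↔ σ • geomSqrt (D : ℚ) = geomSqrt (D : ℚ) := by
  have hD0 : D ≠ 0 := hsq.ne_zero
  obtain ⟨Φ, hΦ, hχ⟩ := KernelDisc.exists_isRationalLine_kernelChar_of_cert hψ hD0 hs hDs
  -- a non-zero point of the line
  haveI : Finite Φ := Nat.finite_of_card_ne_zero (by rw [hΦ.1]; decide)
  haveI : Nontrivial Φ := Finite.one_lt_card_iff_nontrivial.mp (by rw [hΦ.1]; decide)
  obtain ⟨⟨P₀, hP₀⟩, hP₀ne⟩ := exists_ne (0 : Φ)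
  have hP₀0 : P₀ ≠ 0 := fun h ↦ hP₀ne (Subtype.ext h)
  refine ⟨Φ, hΦ, KernelDisc.lineEven_of_pos hχ hpos, ?_, ?_, hχ⟩
  · -- non-trivial action: `D` is not a square, so some `σ` moves `√D`, hence moves `P₀`
    have hnsq : ¬ IsSquare (D : ℚ) :=
      not_isSquare_ratCast_of_squarefree hsq hD1
    obtain ⟨σ, hσ⟩ := exists_smul_geomSqrt_ne_of_not_isSquare hnsq
    refine ⟨σ, P₀, hP₀, fun hfix ↦ hσ ?_⟩
    have hall : ∀ Q ∈ Φ, σ • Q = Q := (KernelDisc.forall_smul_eq_iff_of_mem hΦ hP₀ hP₀0 σ).mpr hfix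
    exact (hχ σ).mp hall
  · -- the `χ_K`-twist is ramified at `3`: an inertia element at `3` fixes `Φ` but negates `√−3`
    intro K _ _ _ h2K hθ hall
    obtain ⟨θ, hθ⟩ := hθ
    obtain ⟨v, hv⟩ :=
      Literature.NumberTheory.NumberFields.RingOfIntegers.exists_heightOneSpectrum_natCast_mem ℚ hp.out
    obtain ⟨σ, hσI, hσneg⟩ := exists_mem_absInertia_smul_geomSqrt_pStar_eq_neg 3 (by decide) hv
    set τ : absoluteGaloisGroup ℚ := absGaloisRestrict ℚ (v.adicCompletion ℚ) σ with hτ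
    have hτI : τ ∈ (adicCompletionPrime ℚ v).inertia (absoluteGaloisGroup ℚ) := by
      rw [inertia_adicCompletionPrime_eq_map_absInertia]
      exact Subgroup.mem_map.2 ⟨σ, hσI, rfl⟩
    -- `τ` fixes `√D` (`3 ∤ 4D`), hence `Φ` pointwise
    have hfixD : τ • geomSqrt ((D : ℤ) : ℚ) = geomSqrt ((D : ℤ) : ℚ) :=
      smul_geomSqrt_eq_of_mem_inertia (p := 3) (not_dvd_four_mul (by decide) h3D) hv
        (adicCompletionPrime_mem_primesAbove ℚ v) hτI
    have hfixΦ : τ • P₀ = P₀ := (hχ τ).mpr hfixD P₀ hP₀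
    -- `τ ∉ galRange K`: it negates `j(θ) = ±√−3`
    have hsqθ := embIntoClosure_sq K hθ
    have hsqr := geomSqrt_sq ((-1 : ℚ) ^ ((3 : ℕ) / 2) * (3 : ℕ))
    have hpm : embIntoClosure (K := ℚ) K θ = geomSqrt ((-1 : ℚ) ^ ((3 : ℕ) / 2) * (3 : ℕ)) ∨
        embIntoClosure (K := ℚ) K θ = -geomSqrt ((-1 : ℚ) ^ ((3 : ℕ) / 2) * (3 : ℕ)) := by
      exact sq_eq_sq_iff_eq_or_eq_neg.mp (hsqθ.trans hsqr.symm)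
    have hr0 : geomSqrt ((-1 : ℚ) ^ ((3 : ℕ) / 2) * (3 : ℕ)) ≠
        -geomSqrt ((-1 : ℚ) ^ ((3 : ℕ) / 2) * (3 : ℕ)) := geomSqrt_ne_neg (by norm_num)
    have hτK : τ ∉ galRange (K := ℚ) K := by
      apply not_mem_galRange_of_smul_embIntoClosure_ne K
      rcases hpm with h | h
      · rw [h, hσneg]
        exact fun e ↦ hr0 e.symm
      · rw [h, smul_neg, hσneg, neg_neg]
        exact hr0
    -- contradiction: `τ • P₀ = -P₀` by `hall`, but `τ` fixes `P₀ ≠ 0`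
    have hτP := hall v hv (adicCompletionPrime ℚ v) (adicCompletionPrime_mem_primesAbove ℚ v) τ hτI
      P₀ hP₀
    rw [if_neg hτK, hfixΦ] at hτP
    -- `P₀ = -P₀` with `3 • P₀ = 0` forces `P₀ = 0`
    apply hP₀0
    refine X2.ResidualDevissageLine.eq_zero_of_two_nsmul_eq_zero (by decide) P₀
      (X2.ResidualDevissageLine.nsmul_eq_zero_of_mem_geomTorsion P₀) ?_
    rw [two_nsmul]
    nth_rewrite 2 [hτP]
    exact add_neg_cancel P₀

/-! ### §2 `χ₈` read in `𝔽₃` is primitive of conductor `8` -/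

/-- **`χ₈` read in `𝔽₃` is PRIMITIVE** (conductor `8`): its conductor divides `8 = 2³` but not `4`,
since `5 ≡ 1 (mod 4)` while `χ₈(5) = −1 ≠ 1` in `𝔽₃` (the tree's `isPrimitive_of_apply_five_eq_neg_one`
argument over `𝔽₃`). [cite: Washington1997, Ch. 3 (conductors of Dirichlet characters)] -/
theorem chi8_three_isPrimitive :
    DirichletCharacter.IsPrimitive
      (ZMod.χ₈.ringHomComp (Int.castRingHom (ZMod 3)) : DirichletCharacter (ZMod 3) 8) := by
  set χ : DirichletCharacter (ZMod 3) 8 := ZMod.χ₈.ringHomComp (Int.castRingHom (ZMod 3)) with hχdef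
  have h5 : χ (5 : ℤ) = -1 := by
    rw [hχdef, MulChar.ringHomComp_apply]
    have h : ZMod.χ₈ ((5 : ℤ) : ZMod 8) = -1 := by decide
    rw [h]
    simp
  rw [DirichletCharacter.isPrimitive_def]
  have hdvd : χ.conductor ∣ 2 ^ 3 := χ.conductor_dvd_level
  have hnot : ¬ χ.conductor ∣ 4 := by
    intro h4
    have hmem : 4 ∈ χ.conductorSet :=
      (χ.mem_conductorSet_iff_conductor_dvd (show 4 ∣ 8 by norm_num)).mpr h4
    obtain ⟨hd, χ₀, hχ₀⟩ := (χ.mem_conductorSet_iff.mp hmem)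
    have hcop : IsCoprime (5 : ℤ) (8 : ℕ) := by
      rw [Int.isCoprime_iff_gcd_eq_one]; decide
    have h5' : χ (5 : ℤ) = χ₀ (5 : ℤ) := by
      rw [hχ₀, DirichletCharacter.changeLevel_eq_cast_of_dvd' χ₀ hd hcop]
    have h51 : ((5 : ℤ) : ZMod 4) = 1 := by decide
    rw [h5, h51, map_one] at h5'
    exact absurd h5' (by decide)
  obtain ⟨k, hk, hk'⟩ := (Nat.dvd_prime_pow Nat.prime_two).mp hdvd
  interval_cases k
  · exact absurd (hk' ▸ one_dvd 4) hnot
  · exact absurd (hk' ▸ (show 2 ∣ 4 by norm_num)) hnot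
  · exact absurd (hk' ▸ dvd_refl 4) hnot
  · rw [hk']; norm_num

/-! ### §3 Kernel discriminant `2`: the characters of the line and of the quotient -/

/-- **The line datum WITH ITS TWO CHARACTERS for the kernel discriminant `D = 2`.** From the
certificate `(x₀, s)` with `Ψ₃(x₀) = 0`, `s ≠ 0`, `2·s² = Ψ₂Sq(x₀)`: a rational `3`-line `Φ₀` which is
even, has non-trivial action and ramified `χ_K`-twist (§1), on which `Γ_ℚ` acts through the PRIMITIVE
character `φ = χ₈` read in `𝔽₃` (`X3Branch.smul_eq_chi8_of_kernel_sq_eq_two`: `√2 = ζ₈ + ζ₈⁻¹`), and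
whose quotient `W[3]/Φ₀` carries the PRIMITIVE character `ψ = ω₃·φ⁻¹` of level `3·8`
(`X3Branch.smul_sub_quotCharacter_mem`, `X3Branch.quotCharacter_isPrimitive`) — every LINE input of the
display form `X3Branch.eval_of_charFacts_of_characters`. [folklore] -/
theorem exists_lineDatum_three_characters_of_cert_two [hp : Fact (Nat.Prime 3)] {x₀ s : ℚ}
    (hψ : W.Ψ₃.eval x₀ = 0) (hs : s ≠ 0) (hDs : ((2 : ℤ) : ℚ) * s ^ 2 = W.Ψ₂Sq.eval x₀) :
    ∃ Φ₀ : AddSubgroup (geomTorsion W ((3 : ℕ) : ℤ)), IsRationalLine W 3 Φ₀ ∧ LineEven W 3 Φ₀ ∧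
      (∃ (σ : absoluteGaloisGroup ℚ) (P : W.geomTorsion ((3 : ℕ) : ℤ)), P ∈ Φ₀ ∧ σ • P ≠ P) ∧
      (∀ (K : Type) [Field K] [NumberField K] [(galRange (K := ℚ) K).Normal],
        Module.finrank ℚ K = 2 →
        (∃ θ : K, θ ^ 2 = algebraMap ℚ K ((-1) ^ ((3 : ℕ) / 2) * (3 : ℕ))) →
        ¬ ∀ v : HeightOneSpectrum (𝓞 ℚ), (((3 : ℕ) : ℕ) : 𝓞 ℚ) ∈ v.asIdeal →
          ∀ 𝔓 ∈ v.primesAbove, ∀ σ ∈ 𝔓.inertia (absoluteGaloisGroup ℚ), ∀ P ∈ Φ₀,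
            σ • P = (if σ ∈ galRange (K := ℚ) K then P else -P)) ∧
      DirichletCharacter.IsPrimitive
        (ZMod.χ₈.ringHomComp (Int.castRingHom (ZMod 3)) : DirichletCharacter (ZMod 3) 8) ∧
      (∀ (σ : absoluteGaloisGroup ℚ), ∀ P ∈ Φ₀,
        σ • P = ((ZMod.χ₈.ringHomComp (Int.castRingHom (ZMod 3)) : DirichletCharacter (ZMod 3) 8)
          ((modNCyclotomicCharacter ℚ 8 σ : (ZMod 8)ˣ) : ZMod 8)).val • P) ∧
      DirichletCharacter.IsPrimitive
        (changeLevel (dvd_mul_right 3 8) (MulChar.ofUnitHom (MonoidHom.id (ZMod 3)ˣ)) *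
          changeLevel (dvd_mul_left 8 3)
            (ZMod.χ₈.ringHomComp (Int.castRingHom (ZMod 3)) : DirichletCharacter (ZMod 3) 8)⁻¹ :
          DirichletCharacter (ZMod 3) (3 * 8)) ∧
      (∀ (σ : absoluteGaloisGroup ℚ) (P : W.geomTorsion ((3 : ℕ) : ℤ)),
        σ • P - ((changeLevel (dvd_mul_right 3 8) (MulChar.ofUnitHom (MonoidHom.id (ZMod 3)ˣ)) *
          changeLevel (dvd_mul_left 8 3)
            (ZMod.χ₈.ringHomComp (Int.castRingHom (ZMod 3)) : DirichletCharacter (ZMod 3) 8)⁻¹ :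
          DirichletCharacter (ZMod 3) (3 * 8))
          ((modNCyclotomicCharacter ℚ (3 * 8) σ : (ZMod (3 * 8))ˣ) : ZMod (3 * 8))).val • P ∈ Φ₀) := by
  have hsq : Squarefree (2 : ℤ) := Int.prime_two.squarefree
  obtain ⟨Φ₀, hΦ, heven, hnt, hram, hχ⟩ :=
    exists_lineDatum_three_kernelField_of_cert' hψ hsq hs hDs (by norm_num) (by norm_num) (by norm_num)
  have hg : geomSqrt ((2 : ℤ) : ℚ) ^ 2 = 2 := by
    rw [geomSqrt_sq, Int.cast_ofNat, map_ofNat]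
  have hφprim := chi8_three_isPrimitive
  have hφ0 : ∀ (σ : absoluteGaloisGroup ℚ), ∀ P ∈ Φ₀,
      σ • P = ((ZMod.χ₈.ringHomComp (Int.castRingHom (ZMod 3)) : DirichletCharacter (ZMod 3) 8)
        ((modNCyclotomicCharacter ℚ 8 σ : (ZMod 8)ˣ) : ZMod 8)).val • P :=
    fun σ P hP ↦ X3Branch.smul_eq_chi8_of_kernel_sq_eq_two hΦ hg hχ σ P hP
  exact ⟨Φ₀, hΦ, heven, hnt, hram, hφprim, hφ0,
    X3Branch.quotCharacter_isPrimitive (p := 3) (by decide) _ hφprim (by norm_num),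
    fun σ P ↦ X3Branch.smul_sub_quotCharacter_mem hΦ _ hφ0 σ P⟩

end Summit.BirchSwinnertonDyer.Rank1Residual.Additive

end
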